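import Summits.NavierStokesRegularity.NavierStokesRegularity.Theorems.RungBlowupCofinal.SolidHarmonicProfileOperator
import HarnessLib

/-!
# Zonal solid harmonics of every degree on the angular Galerkin ladder: the Legendre recursion
# `(j+1) z_{j+1} = (2j+1) y₂ z_j − j‖y‖² z_{j−1}` in the kernel, and the zonal three-profile class
# `a(ρ)∇z_j + b(ρ) z_j x + c(ρ) x × ∇z_j` of every rung
# (route `AngularGalerkinLadder`, crux K1 `RungBlowupCofinal`; kinematic helper, theorems only)

Cell `ns-blowup`, seat `ns-blowup-circuit` (g11, AGL Lean seat). Helper file for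
`stmt-NavierStokesRegularity-19959` serving the line `Cruxes/RungBlowupCofinal/Lines/qlwave.lean`: its
card (§1) reads the ZONAL part `V` of a mean–wave profile (`Qlwave.IsZonal V`, band-limited of degree
`≤ L`) as «`≈ 3(L+1)` real radial functions (`j ≤ L`, `m = 0`)» — the three lifts of the zonal solid
harmonics `z_j = r^j P_j(y₂/r)`. `SolidHarmonicAnsatz.lean` / `SolidHarmonicTransport.lean` typed the
lifts for ANY `φ` with `Δφ = 0`, `Dφ(y)y = jφ`, `K₂φ = 0`; this file supplies such `φ` for every degree
`j`, projection- and coordinate-free, by the Legendre three-term recursion. LABEL: KERNEL kinematics.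
Nothing here asserts a Theses declaration; no definition, no named fact. WHAT THIS IS NOT: not
Navier–Stokes evidence; not a profile — existence of explicit polynomial scalars and the kinematic
letters of their lifts; nothing about the zonal EQUATION.

## Content

With `ℓ(y) = y₂` (any real-linear `ℓ` with `ℓ y = y 2`; `axial_laws`, `gradient_axial`, `laplacian_axial`)
and `ρ = ‖y‖²` (`laplacian_norm_sq = 6`, `gradient_norm_sq = 2y`):

* §2 **`legendre_step`**: from a pair `(p, q) = (z_j, z_{j+1})` of smooth harmonic homogeneous zonal
  scalars with the links `∂₂q = (j+1)p`, `ρ∂₂p = (2j+1)y₂p − (j+1)q` (the recursion one level down)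
  and `p(e₂) = q(e₂) = 1`, the Legendre combination `r = ((2j+3)y₂q − (j+1)ρp)/(j+2)` completes
  `(q, r) = (z_{j+1}, z_{j+2})` with the same twelve invariants (harmonicity: `Δ(y₂q) = 2(j+1)p`,
  `Δ(ρp) = (4j+6)p`, tree `laplacian_smul_field`).
* §3 **`exists_legendre_pair`** (induction from `(1, y₂)`), **`exists_zonalSolidHarmonic`**: for every
  `j` a smooth `z` with `Δz = 0`, `Dz(y)y = jz(y)`, `−Dz(y)(e₂ × y) = 0`, `z(e₂) = 1`.
* §4 **`exists_zonal_threeLift`** (`j ≤ L`, smooth radial `a, b, c`): the zonal three-profile field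
  `V = a(‖x‖²)∇z_j + b(‖x‖²)z_j x + c(‖x‖²) x × ∇z_j` is `IsBandLimited L`, zonal (`J₃V = 0`), a
  `𝒞`-eigenfield `j(j+1)`, and divergence free under `2j a′ + 2ρ b′ + (j+3) b = 0` — the zonal
  counterpart of `SectoralWaveAnsatz`; with `SolidHarmonicProfileOperator` the linear operator `A` on it
  is explicit.

[cite: BullardGellman1954] (zonal harmonics `P_j(cos θ)`, Bonnet's recursion; here as solid harmonics,
projection-free in the tree's Casimir-cut typing).
-/

noncomputable section

namespace Summit.NavierStokesRegularity.AngularGalerkinLadderZonalSolidHarmonics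

open Set Function
open scoped ContDiff RealInnerProductSpace Laplacian
open Literature.Analysis.FluidPDE
open Summit.NavierStokesRegularity.FluidComputer
open Summit.NavierStokesRegularity.FluidComputer.AngularLadder
open Summit.NavierStokesRegularity.AngularGalerkinLadderSolidHarmonicProfileOperator

/-! ## §1 The axial coordinate `ℓ(y) = y₂` and the radius `ρ = ‖y‖²` -/

section Tools

variable (ℓ : EuclideanSpace ℝ (Fin 3) →L[ℝ] ℝ)

/-- `⟪y, e₂ × y⟫ = 0`. [folklore] -/
private theorem inner_self_crossCLM (y : EuclideanSpace ℝ (Fin 3)) : ⟪y, crossCLM (axis 2) y⟫ = 0 := by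
  simp only [crossCLM_apply, cross, PiLp.inner_apply, cross_apply, RCLike.inner_apply, conj_trivial,
    Fin.sum_univ_three, Matrix.cons_val_zero, Matrix.cons_val_one, Matrix.cons_val_two,
    Matrix.head_cons, Matrix.tail_cons]
  ring

/-- The axial coordinate vanishes on `e₂ × y` and equals `1` at `e₂`. [folklore] -/
theorem axial_laws (hℓ : ∀ y, ℓ y = y 2) :
    (∀ y, ℓ (crossCLM (axis 2) y) = 0) ∧ ℓ (axis 2) = 1 ∧ ∀ y w : EuclideanSpace ℝ (Fin 3), ⟪axis 2, w⟫ = ℓ w := by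
  refine ⟨fun y => ?_, ?_, fun y w => ?_⟩
  · rw [hℓ]; simp [crossCLM_apply, cross, cross_apply, axis_apply]
  · rw [hℓ]; simp [axis_apply]
  · rw [hℓ, axis, EuclideanSpace.inner_single_left]; simp

/-- The gradient of a linear functional with `⟪e₂, w⟫ = ℓ w` is the constant `e₂`. [folklore] -/
theorem gradient_axial (hℓ3 : ∀ y w : EuclideanSpace ℝ (Fin 3), ⟪axis 2, w⟫ = ℓ w)
    (x : EuclideanSpace ℝ (Fin 3)) : gradient (fun y => ℓ y) x = axis 2 := by
  refine ext_inner_right ℝ fun w => ?_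
  rw [inner_gradient_left, show (fun y => ℓ y) = ⇑ℓ from rfl, ContinuousLinearMap.fderiv, hℓ3 x w]

/-- The Laplacian of a linear functional vanishes. [folklore] -/
theorem laplacian_axial (x : EuclideanSpace ℝ (Fin 3)) : (Δ fun y => ℓ y) x = 0 := by
  rw [InnerProductSpace.laplacian_eq_iteratedFDeriv_orthonormalBasis _ (EuclideanSpace.basisFun (Fin 3) ℝ)]
  refine Finset.sum_eq_zero fun i _ => ?_
  have h : fderiv ℝ (fun y => ℓ y) = fun _ => ℓ := funext fun z => ℓ.fderiv
  rw [iteratedFDeriv_two_apply, h]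
  simp

/-- `Δ‖y‖² = 6` on `ℝ³`. [folklore] -/
theorem laplacian_norm_sq (x : EuclideanSpace ℝ (Fin 3)) :
    (Δ fun y : EuclideanSpace ℝ (Fin 3) => ‖y‖ ^ 2) x = 6 := by
  have h := laplacian_radial (a := fun t : ℝ => t) contDiff_id x
  simp only [deriv_id'', deriv_const'] at h
  rw [show (fun y : EuclideanSpace ℝ (Fin 3) => (fun t : ℝ => t) (‖y‖ ^ 2)) =
    fun y : EuclideanSpace ℝ (Fin 3) => ‖y‖ ^ 2 from rfl] at h
  rw [h]
  ring

/-- `∇‖y‖² = 2y`. [folklore] -/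
theorem gradient_norm_sq (x : EuclideanSpace ℝ (Fin 3)) :
    gradient (fun y : EuclideanSpace ℝ (Fin 3) => ‖y‖ ^ 2) x = (2 : ℝ) • x := by
  have h := gradient_radial (a := fun t : ℝ => t) differentiable_id x
  simp only [deriv_id'', mul_one] at h
  exact h

/-- `D‖·‖²(x) w = 2⟪x, w⟫`. [folklore] -/
theorem fderiv_norm_sq_apply (x w : EuclideanSpace ℝ (Fin 3)) :
    fderiv ℝ (fun y : EuclideanSpace ℝ (Fin 3) => ‖y‖ ^ 2) x w = 2 * ⟪x, w⟫ := by
  rw [(hasStrictFDerivAt_norm_sq x).hasFDerivAt.fderiv]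
  simp

end Tools

/-! ## §2 One step of the Legendre recursion -/

section Step

variable (ℓ : EuclideanSpace ℝ (Fin 3) →L[ℝ] ℝ) {p q : EuclideanSpace ℝ (Fin 3) → ℝ} {j : ℕ}

/-- **THE LEGENDRE STEP.** From the pair `(z_j, z_{j+1}) = (p, q)` of zonal solid harmonics with its
two derivative links (`∂₂q = (j+1)p`, `ρ∂₂p = (2j+1)y₂p − (j+1)q`, the second one encoding the
recursion one level down) and the normalisation `p(e₂) = q(e₂) = 1`, the Legendre combination
`r = ((2j+3) y₂ q − (j+1) ρ p)/(j+2)` completes the pair `(q, r) = (z_{j+1}, z_{j+2})` with the same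
invariants. [cite: BullardGellman1954] -/
theorem legendre_step (hℓ : ∀ y, ℓ y = y 2)
    (hp : ContDiff ℝ ∞ p) (hq : ContDiff ℝ ∞ q)
    (hpΔ : ∀ y, (Δ p) y = 0) (hqΔ : ∀ y, (Δ q) y = 0)
    (hpE : ∀ y, fderiv ℝ p y y = (j : ℝ) * p y) (hqE : ∀ y, fderiv ℝ q y y = ((j : ℝ) + 1) * q y)
    (hpK : ∀ y, fderiv ℝ p y (crossCLM (axis 2) y) = 0) (hqK : ∀ y, fderiv ℝ q y (crossCLM (axis 2) y) = 0)
    (hq2 : ∀ y, fderiv ℝ q y (axis 2) = ((j : ℝ) + 1) * p y)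
    (hp2 : ∀ y, ‖y‖ ^ 2 * fderiv ℝ p y (axis 2) = (2 * (j : ℝ) + 1) * ℓ y * p y - ((j : ℝ) + 1) * q y)
    (hp1 : p (axis 2) = 1) (hq1 : q (axis 2) = 1) :
    ∃ r : EuclideanSpace ℝ (Fin 3) → ℝ,
      ContDiff ℝ ∞ r ∧ (∀ y, (Δ r) y = 0) ∧ (∀ y, fderiv ℝ r y y = ((j : ℝ) + 2) * r y) ∧
      (∀ y, fderiv ℝ r y (crossCLM (axis 2) y) = 0) ∧
      (∀ y, fderiv ℝ r y (axis 2) = ((j : ℝ) + 2) * q y) ∧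
      (∀ y, ‖y‖ ^ 2 * fderiv ℝ q y (axis 2) = (2 * ((j : ℝ) + 1) + 1) * ℓ y * q y - ((j : ℝ) + 2) * r y) ∧
      r (axis 2) = 1 := by
  obtain ⟨hℓK, hℓ1, hℓ3⟩ := axial_laws ℓ hℓ
  have hj : ((j : ℝ) + 2) ≠ 0 := by positivity
  -- the Legendre combination
  set α : ℝ := (2 * (j : ℝ) + 3) / ((j : ℝ) + 2) with hα
  set γ : ℝ := -(((j : ℝ) + 1) / ((j : ℝ) + 2)) with hγ
  have hqd : Differentiable ℝ q := hq.differentiable (by simp)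
  have hpd : Differentiable ℝ p := hp.differentiable (by simp)
  have hDr : ∀ y w : EuclideanSpace ℝ (Fin 3),
      fderiv ℝ (fun z => α * (ℓ z * q z) + γ * (‖z‖ ^ 2 * p z)) y w =
        α * (ℓ y * fderiv ℝ q y w + q y * ℓ w) + γ * (‖y‖ ^ 2 * fderiv ℝ p y w + p y * (2 * ⟪y, w⟫)) := by
    intro y w
    have hF : HasFDerivAt (fun z => ℓ z * q z) (ℓ y • fderiv ℝ q y + q y • ℓ) y :=
      ℓ.hasFDerivAt.mul (hqd y).hasFDerivAt
    have hG : HasFDerivAt (fun z : EuclideanSpace ℝ (Fin 3) => ‖z‖ ^ 2 * p z)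
        (‖y‖ ^ 2 • fderiv ℝ p y + p y • ((2 : ℕ) • innerSL ℝ y)) y :=
      (hasStrictFDerivAt_norm_sq y).hasFDerivAt.mul (hpd y).hasFDerivAt
    have hr : HasFDerivAt (fun z => α * (ℓ z * q z) + γ * (‖z‖ ^ 2 * p z))
        (α • (ℓ y • fderiv ℝ q y + q y • ℓ) + γ • (‖y‖ ^ 2 • fderiv ℝ p y + p y • ((2 : ℕ) • innerSL ℝ y))) y :=
      (hF.const_mul α).add (hG.const_mul γ)
    rw [hr.fderiv]
    simp only [_root_.add_apply, FunLike.coe_smul, FunLike.coe_add, Pi.smul_apply, Pi.add_apply]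
    simp only [smul_eq_mul, nsmul_eq_mul, Nat.cast_ofNat, innerSL_apply_apply]
  refine ⟨fun y => α * (ℓ y * q y) + γ * (‖y‖ ^ 2 * p y), ?_, ?_, ?_, ?_, ?_, ?_, ?_⟩
  · exact ((contDiff_const.mul (ℓ.contDiff.mul hq))).add
      (contDiff_const.mul ((contDiff_norm_sq ℝ).mul hp))
  · -- harmonicity: Δ(y₂q) = 2∂₂q = 2(j+1)p, Δ(ρp) = 4Dp·y + 6p = (4j+6)p
    intro y
    have hF : ContDiff ℝ ∞ fun z => ℓ z • q z := ℓ.contDiff.smul hq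
    have hG : ContDiff ℝ ∞ fun z : EuclideanSpace ℝ (Fin 3) => ‖z‖ ^ 2 • p z := (contDiff_norm_sq ℝ).smul hp
    have h1 : (Δ fun z => ℓ z • q z) y = (2 * ((j : ℝ) + 1)) * p y := by
      rw [laplacian_smul_field (ℓ.contDiff.of_le le_top) (hq.of_le (by norm_cast)) y, hqΔ y,
        laplacian_axial ℓ y, gradient_axial ℓ hℓ3 y, hq2 y]
      simp only [smul_eq_mul]
      ring
    have h2 : (Δ fun z : EuclideanSpace ℝ (Fin 3) => ‖z‖ ^ 2 • p z) y = (4 * (j : ℝ) + 6) * p y := by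
      rw [laplacian_smul_field ((contDiff_norm_sq ℝ).of_le le_top) (hp.of_le (by norm_cast)) y, hpΔ y,
        laplacian_norm_sq y, gradient_norm_sq y, map_smul, hpE y]
      simp only [smul_eq_mul]
      ring
    have e : (fun z => α * (ℓ z * q z) + γ * (‖z‖ ^ 2 * p z)) =
        (α • fun z => ℓ z • q z) + γ • fun z : EuclideanSpace ℝ (Fin 3) => ‖z‖ ^ 2 • p z := by
      funext z; simp only [Pi.add_apply, Pi.smul_apply, smul_eq_mul]
    have hFα : ContDiff ℝ ∞ (α • fun z => ℓ z • q z) := hF.const_smul α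
    have hGγ : ContDiff ℝ ∞ (γ • fun z : EuclideanSpace ℝ (Fin 3) => ‖z‖ ^ 2 • p z) := hG.const_smul γ
    rw [e, ((hFα.of_le (by norm_cast)).contDiffAt).laplacian_add ((hGγ.of_le (by norm_cast)).contDiffAt),
      InnerProductSpace.laplacian_smul α ((hF.of_le (by norm_cast)).contDiffAt),
      InnerProductSpace.laplacian_smul γ ((hG.of_le (by norm_cast)).contDiffAt), h1, h2]
    rw [hα, hγ]
    simp only [smul_eq_mul]
    field_simp
    ring
  · -- Euler homogeneity of degree j+2
    intro y
    rw [hDr y y, hqE y, hpE y, real_inner_self_eq_norm_sq]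
    ring
  · -- zonal: the derivative along e₂ × y vanishes
    intro y
    rw [hDr y, hqK y, hpK y, hℓK y, inner_self_crossCLM]
    ring
  · -- the link ∂₂r = (j+2) q
    intro y
    have hin : ⟪y, axis 2⟫ = ℓ y := by rw [real_inner_comm]; exact hℓ3 y y
    rw [hDr y (axis 2), hq2 y, hℓ1, hin, hp2 y, hα, hγ]
    field_simp
    ring
  · -- the recursion link one level up
    intro y
    rw [hq2 y, hα, hγ]
    field_simp
    ring
  · -- normalisation at e₂
    have hn : ‖axis (2 : Fin 3)‖ ^ 2 = 1 := by
      rw [EuclideanSpace.norm_sq_eq]; simp [axis_apply]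
    simp only [hℓ1, hq1, hp1, hn, hα, hγ]
    field_simp
    ring

end Step

/-! ## §3 Zonal solid harmonics of every degree -/

section Existence

variable (ℓ : EuclideanSpace ℝ (Fin 3) →L[ℝ] ℝ)

/-- The Laplacian of a constant vanishes. [folklore] -/
private theorem laplacian_const_zero (c : ℝ) (x : EuclideanSpace ℝ (Fin 3)) : (Δ fun _ : EuclideanSpace ℝ (Fin 3) => c) x = 0 := by
  rw [InnerProductSpace.laplacian_eq_iteratedFDeriv_orthonormalBasis _ (EuclideanSpace.basisFun (Fin 3) ℝ)]
  simp [iteratedFDeriv_two_apply]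

/-- **The Legendre ladder**: for every `j` there is a pair `(z_j, z_{j+1})` of smooth ZONAL SOLID
HARMONICS (harmonic, homogeneous of degrees `j`, `j+1`, annihilated by `K₂`) linked by
`∂₂z_{j+1} = (j+1)z_j` and `ρ∂₂z_j = (2j+1)y₂z_j − (j+1)z_{j+1}`, normalised by `z(e₂) = 1` — by
induction from `(1, y₂)` through `legendre_step`. [cite: BullardGellman1954] -/
theorem exists_legendre_pair (hℓ : ∀ y, ℓ y = y 2) (j : ℕ) :
    ∃ p q : EuclideanSpace ℝ (Fin 3) → ℝ, ContDiff ℝ ∞ p ∧ ContDiff ℝ ∞ q ∧ (∀ y, (Δ p) y = 0) ∧ (∀ y, (Δ q) y = 0) ∧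
      (∀ y, fderiv ℝ p y y = (j : ℝ) * p y) ∧ (∀ y, fderiv ℝ q y y = ((j : ℝ) + 1) * q y) ∧
      (∀ y, fderiv ℝ p y (crossCLM (axis 2) y) = 0) ∧ (∀ y, fderiv ℝ q y (crossCLM (axis 2) y) = 0) ∧
      (∀ y, fderiv ℝ q y (axis 2) = ((j : ℝ) + 1) * p y) ∧
      (∀ y, ‖y‖ ^ 2 * fderiv ℝ p y (axis 2) = (2 * (j : ℝ) + 1) * ℓ y * p y - ((j : ℝ) + 1) * q y) ∧
      p (axis 2) = 1 ∧ q (axis 2) = 1 := by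
  obtain ⟨hℓK, hℓ1, hℓ3⟩ := axial_laws ℓ hℓ
  induction j with
  | zero =>
      have hDℓ : ∀ y w : EuclideanSpace ℝ (Fin 3), fderiv ℝ (fun z => ℓ z) y w = ℓ w := fun y w => by
        rw [show (fun z => ℓ z) = ⇑ℓ from rfl, ℓ.fderiv]
      refine ⟨fun _ => 1, fun y => ℓ y, contDiff_const, ℓ.contDiff, laplacian_const_zero 1,
        laplacian_axial ℓ, fun y => by simp, fun y => by rw [hDℓ]; simp, fun y => by simp,
        fun y => by rw [hDℓ, hℓK], fun y => by rw [hDℓ, hℓ1]; simp, fun y => ?_, rfl, hℓ1⟩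
      simp
  | succ j ih =>
      obtain ⟨p, q, hp, hq, hpΔ, hqΔ, hpE, hqE, hpK, hqK, hq2, hp2, hp1, hq1⟩ := ih
      obtain ⟨r, hr, hrΔ, hrE, hrK, hr2, hqr, hr1⟩ :=
        legendre_step ℓ hℓ hp hq hpΔ hqΔ hpE hqE hpK hqK hq2 hp2 hp1 hq1
      refine ⟨q, r, hq, hr, hqΔ, hrΔ, fun y => ?_, fun y => ?_, hqK, hrK, fun y => ?_, fun y => ?_,
        hq1, hr1⟩
      · rw [hqE y]; push_cast; ring
      · rw [hrE y]; push_cast; ring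
      · rw [hr2 y]; push_cast; ring
      · rw [hqr y]; push_cast; ring

/-- **ZONAL SOLID HARMONICS OF EVERY DEGREE**: for every `j` there is a smooth `z : ℝ³ → ℝ` with
`Δz = 0`, `Dz(y)y = j z(y)` (homogeneous of degree `j`), `K₂z = 0` (zonal: `−Dz(y)(e₂ × y) = 0`) and
`z(e₂) = 1` — the solid zonal harmonic `r^j P_j(y₂/r)`, here produced by the Legendre recursion
`(j+1) z_{j+1} = (2j+1) y₂ z_j − j‖y‖² z_{j−1}` without coordinates on the sphere. These are exactly
the hypotheses of `SolidHarmonicAnsatz.zonal_threeLift` / `SolidHarmonicTransport`.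
[cite: BullardGellman1954] -/
theorem exists_zonalSolidHarmonic (j : ℕ) :
    ∃ z : EuclideanSpace ℝ (Fin 3) → ℝ, ContDiff ℝ ∞ z ∧ (∀ y, (Δ z) y = 0) ∧ (∀ y, fderiv ℝ z y y = (j : ℝ) * z y) ∧
      (∀ y, -fderiv ℝ z y (crossCLM (axis 2) y) = 0) ∧ z (axis 2) = 1 := by
  obtain ⟨p, -, hp, -, hpΔ, -, hpE, -, hpK, -, -, -, hp1, -⟩ :=
    exists_legendre_pair (EuclideanSpace.proj (2 : Fin 3)) (fun y => rfl) j
  exact ⟨p, hp, hpΔ, hpE, fun y => by rw [hpK y, neg_zero], hp1⟩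

end Existence

/-! ## §4 The zonal three-lift class of rung `L` -/

section ZonalClass

open Summit.NavierStokesRegularity.AngularGalerkinLadderSolidHarmonicAnsatz

variable {a b c : ℝ → ℝ} {L j : ℕ}

/-- **THE ZONAL THREE-PROFILE CLASS IS INHABITED AT EVERY DEGREE `j ≤ L`**: with the zonal solid
harmonic `z_j` of `exists_zonalSolidHarmonic` and any smooth radial profiles `a, b, c`, the field
`V = a(‖x‖²)∇z_j + b(‖x‖²) z_j x + c(‖x‖²) x × ∇z_j` is band-limited of degree `≤ L`, ZONAL
(`J₃V = 0`, the letter of `Qlwave.IsZonal`), a `𝒞`-eigenfield `j(j+1)`, and divergence free under the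
radial ODE `2j a′ + 2ρ b′ + (j+3) b = 0` — the zonal counterpart of
`SectoralWaveAnsatz.{isBandLimited,wave,casimir,isDivFree}_sectoralAnsatz`; summing over `j ≤ L` spans
the zonal radial ansatz of the qlwave card's §1–§2 (`≈ 3(L+1)` radial functions).
[cite: BullardGellman1954] -/
theorem exists_zonal_threeLift (hjL : j ≤ L) (ha : ContDiff ℝ ∞ a) (hb : ContDiff ℝ ∞ b)
    (hc : ContDiff ℝ ∞ c) :
    ∃ z : EuclideanSpace ℝ (Fin 3) → ℝ, z (axis 2) = 1 ∧ ContDiff ℝ ∞ z ∧ (∀ y, (Δ z) y = 0) ∧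
      (∀ y, fderiv ℝ z y y = (j : ℝ) * z y) ∧
      IsBandLimited L (fun x : EuclideanSpace ℝ (Fin 3) =>
        a (‖x‖ ^ 2) • gradient z x + b (‖x‖ ^ 2) • (z x • x) + c (‖x‖ ^ 2) • cross x (gradient z x)) ∧
      (∀ y, angGen 2 (fun x : EuclideanSpace ℝ (Fin 3) =>
        a (‖x‖ ^ 2) • gradient z x + b (‖x‖ ^ 2) • (z x • x) + c (‖x‖ ^ 2) • cross x (gradient z x)) y = 0) ∧
      casimir (fun x : EuclideanSpace ℝ (Fin 3) =>
        a (‖x‖ ^ 2) • gradient z x + b (‖x‖ ^ 2) • (z x • x) + c (‖x‖ ^ 2) • cross x (gradient z x)) =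
        ((j : ℝ) * ((j : ℝ) + 1)) • (fun x : EuclideanSpace ℝ (Fin 3) =>
          a (‖x‖ ^ 2) • gradient z x + b (‖x‖ ^ 2) • (z x • x) + c (‖x‖ ^ 2) • cross x (gradient z x)) ∧
      ((∀ ρ : ℝ, 0 ≤ ρ → 2 * (j : ℝ) * deriv a ρ + 2 * ρ * deriv b ρ + ((j : ℝ) + 3) * b ρ = 0) →
        VectorCalculus.IsDivFree fun x : EuclideanSpace ℝ (Fin 3) =>
          a (‖x‖ ^ 2) • gradient z x + b (‖x‖ ^ 2) • (z x • x) + c (‖x‖ ^ 2) • cross x (gradient z x)) := by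
  obtain ⟨z, hz, hzΔ, hzE, hzK, hz1⟩ := exists_zonalSolidHarmonic j
  exact ⟨z, hz1, hz, hzΔ, hzE, isBandLimited_threeLift ha hb hc hz hzΔ hzE hjL,
    zonal_threeLift ha hb hc hz hzK, casimir_threeLift ha hb hc hz hzΔ hzE,
    fun hODE => isDivFree_threeLift ha hb hc hz hzΔ hzE hODE⟩

end ZonalClass

end Summit.NavierStokesRegularity.AngularGalerkinLadderZonalSolidHarmonics

end
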